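import Literature.AlgebraicGeometry.Frobenioids.PerfectionFrobeniusArrows
import Literature.AlgebraicGeometry.Frobenioids.PerfectionCoAngularPreSteps
import Literature.AlgebraicGeometry.Frobenioids.PerfectionPreSteps
import Literature.AlgebraicGeometry.Frobenioids.PerfectionPreFrobenioid
import HarnessLib

/-!
# Frobenioids I, Definition 3.1 (iii) / Proposition 3.2: root arrows of the perfection `C^pf`, and
# arrows of Frobenius type of `C^pf` are monomorphisms (PROOFS)

Mochizuki, *The geometry of Frobenioids I: the general theory*, Kyushu J. Math. **62** (2008), Definition
3.1 (iii) p. 57 ("the pair `(A, n)` is to be thought of as an '`n`-th root' of `A`"), Proposition 3.2 (iii)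
p. 59 ("`C^pf` … is a Frobenioid of perfect and isotropic type") [cite: MochizukiFrdI2008, Prop. 3.2 (iii) p.59].

PROOF-ONLY bookkeeping for THE perfection `Perfection hF` (seat abc-iut-L1-d9's chain), used by the
`1`-uniqueness of `Ψ^pf` in Thm. 3.4 (iii) (`PerfectionSquareUnique.lean`, seat abc-iut-L1-d1); no new
definitions, every arrow is written out as the class `Hom.mk ⟨level, arrow of C⟩` of a representative:

* ROOT ARROWS.  For `X = (A, n)` and `a ≥ 1` the class `κ_{X,a} : (A, n) → (A^{(a)}, 1) = toPf (A^{(a)})`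
  at level `(a, N)`, `n·a = N`, of the chosen Frobenius arrow `A^{(a)} → (A^{(a)})^{(N)}` is of Frobenius
  type of degree `N` (`isFrobeniusType_mkFrob`, `degFr_mkFrob`); **every arrow of `C^pf` sits in a square
  of root arrows over an arrow of `C`**: `[θ] ≫ κ_{Y,b} = κ_{X,a} ≫ toPf θ` for a representative
  `θ : A^{(a)} → B^{(b)}` (`mk_comp_mkFrob`); and `κ_{X,a} = κ_{X,1} ≫ toPf (A^{(1)} → A^{(a)})`
  (`mkFrob_eq_mkFrob_one_comp`).
* MONOMORPHISMS.  A perfected morphism represented by an arrow of Frobenius type of `C` is a monomorphism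
  of `C^pf` (`mono_mk_of_isFrobeniusType`, ANY Frobenioid): two composites that agree are transported to a
  common level, where the Frobenius-type factor is a transition morphism up to an isomorphism (Def. 1.3
  (ii)); one further transport (Prop. 1.10 (i)) cancels it — the perfection kills the unit torsion that
  prevents arrows of Frobenius type from being monomorphisms in `C` itself.  Hence, for `C` of
  Frobenius-isotropic type, every arrow of Frobenius type of `C^pf` is a monomorphism
  (`mono_of_isFrobeniusType`, via `exists_iso_comp_powerMap`).
* ISOMORPHISMS.  An arrow of Frobenius type followed by an isomorphism is of Frobenius type, of the same
  degree (`C` of Frobenius-isotropic type; isomorphisms are isometries, `PerfectionPreFrobenioid.lean`).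
Nothing here is specific to the abc programme.
-/

namespace Literature.AlgebraicGeometry.Frobenioids

namespace PreFrobenioid

namespace Perfection

open CategoryTheory Opposite

universe w v v' u u'

section RootArrows

variable {D : Type u} [Category.{v} D] {Φ : Dᵒᵖ ⥤ CommMonCat.{w}}
  {C : Type u'} [Category.{v'} C] {F : C ⥤ ElemFrobenioid Φ} {hF : IsFrobenioid F}
  {X Y Z : Perfection hF}

/-! ### The root arrows `κ_{X,a} : (A, n) → (A^{(a)}, 1)` -/

/-- The root arrow `κ_{X,a} : (A, n) → (A^{(a)}, 1)` — the class at level `(a, N)`, `n·a = N`, of the chosen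
Frobenius arrow `A^{(a)} → (A^{(a)})^{(N)}` — is of Frobenius type in `C^pf`.
[cite: MochizukiFrdI2008, Prop. 3.2 (ii) p.59] -/
theorem isFrobeniusType_mkFrob (X : Perfection hF) (a N : ℕ+) (h : X.idx * a = 1 * N) :
    (ops hF).IsFrobeniusType (X := X) (Y := root hF (frobPow hF X.obj a) 1)
      (Hom.mk ⟨⟨a, N, h⟩, frob hF (frobPow hF X.obj a) N⟩) :=
  isFrobeniusType_mk_of _ (isFrobeniusType_frob hF _ N)

/-- The root arrow `κ_{X,a}` has Frobenius degree `N = n·a`. [cite: MochizukiFrdI2008, Prop. 3.2 (i) p.58] -/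
theorem degFr_mkFrob (X : Perfection hF) (a N : ℕ+) (h : X.idx * a = 1 * N) :
    (ops hF).degFr (A := X) (B := root hF (frobPow hF X.obj a) 1)
      (Hom.mk ⟨⟨a, N, h⟩, frob hF (frobPow hF X.obj a) N⟩) = N :=
  (degFr_mk_eq _).trans (degFr_frob hF _ N)

/-- **Every arrow of `C^pf` sits in a square of root arrows over an arrow of `C`**: for a representative
`θ : A^{(a)} → B^{(b)}` of `(A, n) → (B, m)` (`n·a = m·b = N`), `[θ] ≫ κ_{Y,b} = κ_{X,a} ≫ toPf θ` in `C^pf`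
(both composites are represented at level `(a, N)` by `θ ≫ (B^{(b)} → (B^{(b)})^{(N)})`, Prop. 1.10 (i)).
[cite: MochizukiFrdI2008, Def. 3.1 (iii) p.57] -/
theorem mk_comp_mkFrob (r : Rep X Y) (N : ℕ+) (hX : X.idx * r.L.a = 1 * N) (hY : Y.idx * r.L.b = 1 * N) :
    (Hom.mk r ≫ Hom.mk (⟨⟨r.L.b, N, hY⟩, frob hF (frobPow hF Y.obj r.L.b) N⟩ :
        Rep Y (root hF (frobPow hF Y.obj r.L.b) 1)) : X ⟶ root hF (frobPow hF Y.obj r.L.b) 1) =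
      Hom.mk (⟨⟨r.L.a, N, hX⟩, frob hF (frobPow hF X.obj r.L.a) N⟩ : Rep X (root hF (frobPow hF X.obj r.L.a) 1)) ≫
        (toPf hF).map r.hom := by
  obtain ⟨⟨a, b, eq⟩, θ⟩ := r
  let T : Level₃ X Y (root hF (frobPow hF Y.obj b) 1) := ⟨a, b, N, eq, hY⟩
  let T' : Level₃ X (root hF (frobPow hF X.obj a) 1) (root hF (frobPow hF Y.obj b) 1) := ⟨a, N, N, hX, rfl⟩
  change (Hom.mk ⟨⟨a, b, eq⟩, θ⟩ ≫ Hom.mk _ : X ⟶ root hF (frobPow hF Y.obj b) 1) =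
    (Hom.mk _ : X ⟶ root hF (frobPow hF X.obj a) 1) ≫
      (Hom.mk (toPfRep hF θ) : root hF (frobPow hF X.obj a) 1 ⟶ root hF (frobPow hF Y.obj b) 1)
  rw [mk_comp_mk, ← mk_compAt T ⟨⟨a, b, eq⟩, θ⟩ _ (Level.le_rfl _) (Level.le_rfl _), mk_comp_mk,
    ← mk_compAt T' ⟨⟨a, N, hX⟩, frob hF (frobPow hF X.obj a) N⟩ (toPfRep hF θ) (Level.le_rfl _)
      ⟨one_dvd _, one_dvd _⟩]
  have key := frob_lift_toPfRep (hF := hF) θ T'.snd ⟨one_dvd _, one_dvd _⟩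
  rw [frob_frobTrans, frob_frobTrans] at key
  unfold compAt
  rw [Level.lift_rfl, Level.lift_rfl, Level.lift_rfl]
  exact congrArg (fun φ => Hom.mk (⟨⟨a, N, hX⟩, φ⟩ : Rep X (root hF (frobPow hF Y.obj b) 1))) key.symm

/-- `κ_{X,a} = κ_{X,1} ≫ toPf (A^{(1)} → A^{(a)})`: the root arrows of one object differ by the images of
the transition morphisms. [cite: MochizukiFrdI2008, Def. 3.1 (iii) p.57] -/
theorem mkFrob_eq_mkFrob_one_comp (X : Perfection hF) (a N : ℕ+) (h : X.idx * a = 1 * N)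
    (h₁ : X.idx * 1 = 1 * X.idx) :
    (Hom.mk (⟨⟨a, N, h⟩, frob hF (frobPow hF X.obj a) N⟩ : Rep X (root hF (frobPow hF X.obj a) 1)) :
        X ⟶ root hF (frobPow hF X.obj a) 1) =
      Hom.mk (⟨⟨1, X.idx, h₁⟩, frob hF (frobPow hF X.obj 1) X.idx⟩ : Rep X (root hF (frobPow hF X.obj 1) 1)) ≫
        (toPf hF).map (frobTrans hF X.obj (one_dvd a)) := by
  let T : Level₃ X (root hF (frobPow hF X.obj 1) 1) (root hF (frobPow hF X.obj a) 1) :=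
    ⟨1, X.idx, X.idx, h₁, rfl⟩
  change _ = (Hom.mk _ ≫ Hom.mk (toPfRep hF (frobTrans hF X.obj (one_dvd a))) :
    X ⟶ root hF (frobPow hF X.obj a) 1)
  rw [mk_comp_mk, ← mk_compAt T ⟨⟨1, X.idx, h₁⟩, frob hF (frobPow hF X.obj 1) X.idx⟩ (toPfRep hF _)
    (Level.le_rfl _) ⟨one_dvd _, one_dvd _⟩]
  have key : frob hF (frobPow hF X.obj 1) X.idx ≫
      Level.lift (toPfRep hF (frobTrans hF X.obj (one_dvd a))).L T.snd ⟨one_dvd _, one_dvd _⟩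
        (toPfRep hF (frobTrans hF X.obj (one_dvd a))).hom =
      frobTrans hF X.obj (one_dvd a) ≫ frob hF (frobPow hF X.obj a) X.idx := by
    have k := frob_lift_toPfRep (hF := hF) (frobTrans hF X.obj (one_dvd a)) T.snd ⟨one_dvd _, one_dvd _⟩
    rw [frob_frobTrans, frob_frobTrans] at k
    exact k
  have hN : X.idx ∣ N := Dvd.intro a (by rw [h, one_mul])
  have hle : T.out.LE ⟨a, N, h⟩ := ⟨one_dvd a, hN⟩
  symm
  rw [← Hom.mk_lift ⟨T.out, _⟩ ⟨a, N, h⟩ hle]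
  refine congrArg (fun φ => Hom.mk (⟨⟨a, N, h⟩, φ⟩ : Rep X (root hF (frobPow hF X.obj a) 1))) ?_
  symm
  refine Level.lift_unique T.out ⟨a, N, h⟩ hle ?_
  change frobTrans hF X.obj (one_dvd a) ≫ frob hF (frobPow hF X.obj a) N =
    compAt T _ _ _ _ ≫ frobTrans hF (frobPow hF X.obj a) hN
  unfold compAt
  rw [Level.lift_rfl, key, Category.assoc, frob_frobTrans]

/-! ### Arrows of Frobenius type give monomorphisms of `C^pf` -/

/-- **A perfected morphism represented by an arrow of Frobenius type of `C` is a monomorphism of `C^pf`**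
(any Frobenioid).  Two composites `γᵢ ≫ [b]` that agree are transported to one common level, where they read
`γᵢ″ ≫ b″` with `b″` a transport of `b`, of Frobenius type in `C` (Prop. 1.10 (i)), hence a transition
morphism followed by an isomorphism (Def. 1.3 (ii)); one further transport of the `γᵢ″` along that transition
and the total epimorphicity of `C` give `γ₁‴ = γ₂‴`. [cite: MochizukiFrdI2008, Def. 3.1 (iii) p.57] -/
theorem mono_mk_of_isFrobeniusType (b : Rep X Y) (hb : IsFrobeniusType F b.hom) :
    Mono (X := X) (Y := Y) (Hom.mk b) := by
  refine ⟨fun {Z} γ₁ γ₂ e => ?_⟩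
  obtain ⟨g₁, rfl⟩ := Hom.mk_surjective γ₁
  obtain ⟨g₂, rfl⟩ := Hom.mk_surjective γ₂
  obtain ⟨T, h₁, h₂, hbT⟩ := exists_level₃ g₁ g₂ b
  have e' : Hom.mk ⟨T.out, compAt T g₁ b h₁ hbT⟩ = Hom.mk ⟨T.out, compAt T g₂ b h₂ hbT⟩ := by
    rw [mk_compAt T g₁ b h₁ hbT, mk_compAt T g₂ b h₂ hbT]
    exact e
  obtain ⟨M, hM₁, hM₂, eM⟩ := Hom.mk_eq_mk.mp e'
  -- scale the triple level by `t := M.a * M.b`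
  let t : ℕ+ := M.a * M.b
  let L₁ : Level Z X := ⟨T.a * t, T.b * t, by rw [← mul_assoc, T.eq₁, mul_assoc]⟩
  let L₂ : Level X Y := ⟨T.b * t, T.c * t, by rw [← mul_assoc, T.eq₂, mul_assoc]⟩
  let L : Level Z Y := ⟨T.a * t, T.c * t, by rw [← mul_assoc, T.eq₁.trans T.eq₂, mul_assoc]⟩
  have k₁ : T.fst.LE L₁ := ⟨dvd_mul_right _ _, dvd_mul_right _ _⟩
  have k₂ : T.snd.LE L₂ := ⟨dvd_mul_right _ _, dvd_mul_right _ _⟩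
  have hL : T.out.LE L := ⟨dvd_mul_right _ _, dvd_mul_right _ _⟩
  have hML : M.LE L :=
    ⟨(Dvd.intro M.b rfl : M.a ∣ t).trans (dvd_mul_left _ _),
      (Dvd.intro M.a (mul_comm _ _) : M.b ∣ t).trans (dvd_mul_left _ _)⟩
  have eL := lift_eq_lift_of_le hM₁ hM₂ eM hML hL hL
  change Level.lift T.out L hL (compAt T g₁ b h₁ hbT) = Level.lift T.out L hL (compAt T g₂ b h₂ hbT) at eL
  unfold compAt Level.lift at eL
  rw [liftLevel_comp hF _ _ hL.1 k₁.2 hL.2 (Level.degFr_eq T.fst L₁ k₁) (Level.degFr_eq T.snd L₂ k₂),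
    liftLevel_comp hF _ _ hL.1 k₁.2 hL.2 (Level.degFr_eq T.fst L₁ k₁) (Level.degFr_eq T.snd L₂ k₂)] at eL
  -- the transported representative of `[b]` is of Frobenius type in `C`
  have hb' : IsFrobeniusType F (Level.lift b.L T.snd hbT b.hom) :=
    IsFrobeniusType.frobeniusConjugate hF hb (Level.lift_spec b.L T.snd hbT b.hom)
      (isFrobeniusType_frobTrans hF _ hbT.1) (isFrobeniusType_frobTrans hF _ hbT.2) (Level.degFr_eq b.L T.snd hbT)
  have hb'' : IsFrobeniusType F (Level.lift T.snd L₂ k₂ (Level.lift b.L T.snd hbT b.hom)) :=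
    IsFrobeniusType.frobeniusConjugate hF hb' (Level.lift_spec T.snd L₂ k₂ _)
      (isFrobeniusType_frobTrans hF _ k₂.1) (isFrobeniusType_frobTrans hF _ k₂.2) (Level.degFr_eq T.snd L₂ k₂)
  -- Def. 1.3 (ii): it is the transition of degree `d` out of `X^{(b·t)}` up to an isomorphism
  obtain ⟨d, hd⟩ : ∃ d, degFr F (Level.lift T.snd L₂ k₂ (Level.lift b.L T.snd hbT b.hom)) = d := ⟨_, rfl⟩
  have hdeg : degFr F (frobTrans hF X.obj (dvd_mul_right (T.b * t) d)) = d :=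
    mul_left_cancel (degFr_frobTrans hF X.obj (dvd_mul_right (T.b * t) d))
  obtain ⟨j, hj⟩ := hF.ii_unique _ _ hb'' (isFrobeniusType_frobTrans hF X.obj (dvd_mul_right (T.b * t) d))
    (hd.trans hdeg.symm)
  -- one further transport of the `γᵢ″`, to the level `(a·t·d, b·t·d)`
  let L₁' : Level Z X := ⟨T.a * t * d, T.b * t * d, by
    rw [show T.a * t * d = T.a * (t * d) from mul_assoc _ _ _,
      show T.b * t * d = T.b * (t * d) from mul_assoc _ _ _, ← mul_assoc, T.eq₁, mul_assoc]⟩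
  have k₁' : L₁.LE L₁' := ⟨dvd_mul_right _ _, dvd_mul_right _ _⟩
  have eγ : Level.lift L₁ L₁' k₁' (Level.lift T.fst L₁ k₁ (Level.lift g₁.L T.fst h₁ g₁.hom)) =
      Level.lift L₁ L₁' k₁' (Level.lift T.fst L₁ k₁ (Level.lift g₂.L T.fst h₂ g₂.hom)) := by
    apply Level.lift_unique
    rw [Level.lift_spec]
    change _ = _ ≫ frobTrans hF X.obj (dvd_mul_right (T.b * t) d)
    rw [← hj, ← Category.assoc, ← Category.assoc]
    exact congrArg (· ≫ j.hom) eL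
  -- back to `C^pf`
  rw [← Hom.mk_lift g₁ T.fst h₁, ← Hom.mk_lift ⟨T.fst, Level.lift g₁.L T.fst h₁ g₁.hom⟩ L₁ k₁,
    ← Hom.mk_lift ⟨L₁, _⟩ L₁' k₁',
    ← Hom.mk_lift g₂ T.fst h₂, ← Hom.mk_lift ⟨T.fst, Level.lift g₂.L T.fst h₂ g₂.hom⟩ L₁ k₁,
    ← Hom.mk_lift ⟨L₁, Level.lift T.fst L₁ k₁ (Level.lift g₂.L T.fst h₂ g₂.hom)⟩ L₁' k₁']
  exact congrArg (fun φ => Hom.mk (X := Z) (Y := X) ⟨L₁', φ⟩) eγ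

/-- An arrow of Frobenius type of `C^pf` is a monomorphism, for `C` of Frobenius-isotropic type (it is a
power map up to an isomorphism of the domain, `exists_iso_comp_powerMap`).
[cite: MochizukiFrdI2008, Prop. 3.2 (iii) p.59] -/
theorem mono_of_isFrobeniusType (hiso : IsOfType (IsFrobeniusIsotropic F)) {W : Perfection hF}
    (φ : W ⟶ X) (hφ : (ops hF).IsFrobeniusType φ) : Mono φ := by
  obtain ⟨B, m⟩ := X
  obtain ⟨n, hn⟩ : ∃ n, (ops hF).degFr φ = n := ⟨_, rfl⟩
  obtain ⟨e, he, rfl⟩ := exists_iso_comp_powerMap hiso φ hφ hn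
  haveI := he
  haveI := mono_mk_of_isFrobeniusType (X := (⟨B, m * n⟩ : Perfection hF)) (Y := ⟨B, m⟩)
    ⟨⟨1, n, mul_one _⟩, frobTrans hF B (one_dvd n)⟩ (isFrobeniusType_frobTrans hF B (one_dvd n))
  exact mono_comp _ _

end RootArrows

section IsoClosure

variable {D : Type u} [Category.{v} D] {Φ : Dᵒᵖ ⥤ CommMonCat.{w}}
  {C : Type u'} [Category.{v'} C] {F : C ⥤ ElemFrobenioid Φ} {hF : IsFrobenioid F}

/-! ### Arrows of Frobenius type of `C^pf` followed by isomorphisms -/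

/-- For `C` of Frobenius-isotropic type, an arrow of Frobenius type of `C^pf` followed by an isomorphism is
of Frobenius type (every arrow of `C^pf` is co-angular; isomorphisms are isometric base-isomorphisms).
[cite: MochizukiFrdI2008, Prop. 3.2 (iii) p.59] -/
theorem isFrobeniusType_comp_isIso (hiso : IsOfType (IsFrobeniusIsotropic F)) {X Y Z : Perfection hF}
    {φ : X ⟶ Y} (hφ : (ops hF).IsFrobeniusType φ) (e : Y ⟶ Z) [IsIso e] :
    (ops hF).IsFrobeniusType (φ ≫ e) := by
  refine ⟨⟨isCoAngular_of_frobeniusIsotropic hiso _, ?_⟩, ?_⟩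
  · change (ops hF).div (φ ≫ e) = 1
    rw [(ops hF).div_comp, show (ops hF).div e = 1 from isIsometry_of_isIso e, map_one, one_mul,
      show (ops hF).div φ = 1 from hφ.1.2, one_pow]
  · change IsIso ((ops hF).base.map (φ ≫ e))
    rw [Functor.map_comp]
    haveI : IsIso ((ops hF).base.map φ) := hφ.2
    infer_instance

/-- … and it has the Frobenius degree of its first factor. [cite: MochizukiFrdI2008, Rem. 1.1.1 p.21] -/
theorem degFr_comp_isIso_pf {X Y Z : Perfection hF} (φ : X ⟶ Y) (e : Y ⟶ Z) [IsIso e] :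
    (ops hF).degFr (φ ≫ e) = (ops hF).degFr φ := by
  rw [(ops hF).degFr_comp, degFr_eq_one_of_isIso e, mul_one]

end IsoClosure

end Perfection

end PreFrobenioid

end Literature.AlgebraicGeometry.Frobenioids
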